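import Literature.Computability.Cryptography.RegevSamplerMachine
import Literature.Computability.Cryptography.RegevSamplerCnotLayer
import HarnessLib

/-!
# Regev 2009, Lemma 3.14 in machine form: the machine circuit with the DATA-FREE erase layer

Topic `Computability/Cryptography` (family `pqc`), grouping namespace `Regev2009.SamplerRegs`; sequel of
`RegevSamplerMachine.lean` (`machineCirc`: GR stage, `notLayer Lr` erasing the Grover–Rudolph parameter word, classical
stage, QFT stage; `runOn_machineCirc`) and `RegevSamplerCnotLayer.lean` (`cnotLayer σ T`, its basis map `xorOn`, and
`cnotLayer_mulVec_eq_notLayer_mulVec`).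

The erase list `Lr = eraseList …` of `machineCirc` is instance data (the positions of the `1`s of the parameter word), so
`machineCirc` cannot be the circuit of a uniform family indexed by the sizes. `machineCircU` is the same circuit with
the erase layer replaced by the data-free `cnotLayer σ T` controlled on a classical copy of the word kept on wires off
the blocks [Regev 2009, Lemma 3.14 (proof); Nielsen–Chuang 2010, §3.2.5]:

* `machineCircU` (definition) and `runOn_machineCircU` (the four stage matrices in turn);
* `notLayer_mulVec_congr` — `NOT` layers with the same wire set act equally;
* `runOn_machineCircU_eq_runOn_machineCirc` — **on a basis label whose off-block source wires carry the word, the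
  data-free machine circuit and `machineCirc` produce the SAME state**: the GR stage output is a product state over the
  label (`GRStage.stageCircuit_mulVec_basisState`), hence supported on labels agreeing with it off the blocks, where
  the controlled layer is the `NOT` layer of the targets whose source bit is set (`cnotLayer_mulVec_eq_notLayer_mulVec`);
  so every law-level statement about `machineCirc` run on such a label (`tvDist_machineCirc_le_std`, …) transfers verbatim.

Everything is proved; no named fact is introduced.
HONEST FRAMING: kernel-checked lemmas of a KNOWN reduction (Regev 2009) — not summit progress.

## References

* O. Regev, *On lattices, learning with errors, random linear codes, and cryptography*, J. ACM 56 (2009), art. 34: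
  Lemma 3.14 (proof), Lemma 3.3 (proof) [Regev2009].
* M. A. Nielsen, I. L. Chuang, *Quantum Computation and Quantum Information*, CUP 2010, §3.2.5, §4.2, §2.1.7
  [NielsenChuang2010].
-/

noncomputable section

namespace Literature.Computability.Cryptography

namespace Regev2009

namespace SamplerRegs

open Literature.Algebra.EuclideanLattices Literature.Computability.QuantumComplexity
  Literature.Computability.QuantumComplexity.TidyBlockFn Finset _root_.Matrix SamplerClassical SamplerClassical.Layout
  SamplerSubst

variable {W : ℕ}

/-- `NOT` layers on the same set of (distinct) wires act equally. [folklore] -/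
theorem notLayer_mulVec_congr (A : Language Bool) {L L' : List (Fin W)} (hL : L.Nodup) (hL' : L'.Nodup)
    (h : ∀ w, w ∈ L ↔ w ∈ L') (φ : QReg W → ℂ) : (notLayer L).toMatrix A *ᵥ φ = (notLayer L').toMatrix A *ᵥ φ := by
  have hflip : flipOn L = flipOn L' := by
    funext z q
    unfold flipOn
    by_cases hq : q ∈ L
    · rw [if_pos hq, if_pos ((h q).1 hq)]
    · rw [if_neg hq, if_neg (fun hq' => hq ((h q).2 hq'))]
  rw [(isBasisMap_notLayer A L hL).mulVec_eq_sum, (isBasisMap_notLayer A L' hL').mulVec_eq_sum, hflip]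

variable (I : LatticeInstance) {Λ : Layout W I.n} (hΛ : Λ.OK)

/-- **The machine circuit with the data-free erase layer**: the GR stage, the `CNOT` layer `cnotLayer σ T` (every
non-point block wire XORed with its classical source off the blocks), the classical stage with the tidy blocks of the
`CVP` subroutine family, the QFT stage. Its gate list depends on the sizes and wire positions only.
[cite: Regev2009, Lemma 3.14 (proof), Lemma 3.3 (proof)] [cite: NielsenChuang2010, §3.2.5] -/
def machineCircU (hF : Fits Λ) (Rf : UniformQCircuitFamily) (Z : SubZone Λ (Rf.family.ancillas Λ.kq))
    {B : ℕ} {kit : GadgetKit B} {ws : Fin Λ.ℓ ↪ Fin B} {np : ℕ} {pw : Fin np ↪ Fin B} {ag : Fin Λ.ℓ → (Fin Λ.ℓ → Bool) → ℝ}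
    (D : GRBlock.Data kit ws pw ag) (E : Fin I.n → (Fin B ↪ Fin W)) (σ : Fin W → Fin W) (T : List (Fin W))
    (kF : ℕ) (hk : 1 ≤ kF) (hroom : Λ.base + I.n * QFTKit.qbsize Λ.ℓR kF ≤ W) : QCircuit cliffordT W :=
  (((GRStage.stageCircuit D E).append (cnotLayer σ T)).append
      (stageCirc hΛ hF (subE hΛ Z) (tidyCirc (ℓ := I.n * Λ.bc) (Rf.family.circ Λ.kq)))).append
    (QFTStage.stageCircuit (qftBlock I hΛ kF hroom) hk)

/-- Running the data-free machine circuit is applying the four stage matrices in turn. [cite: NielsenChuang2010, §4.2] -/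
theorem runOn_machineCircU (hF : Fits Λ) (Rf : UniformQCircuitFamily) (Z : SubZone Λ (Rf.family.ancillas Λ.kq))
    {B : ℕ} {kit : GadgetKit B} {ws : Fin Λ.ℓ ↪ Fin B} {np : ℕ} {pw : Fin np ↪ Fin B} {ag : Fin Λ.ℓ → (Fin Λ.ℓ → Bool) → ℝ}
    (D : GRBlock.Data kit ws pw ag) (E : Fin I.n → (Fin B ↪ Fin W)) (σ : Fin W → Fin W) (T : List (Fin W))
    (kF : ℕ) (hk : 1 ≤ kF) (hroom : Λ.base + I.n * QFTKit.qbsize Λ.ℓR kF ≤ W) (ψ : QReg W → ℂ) :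
    (machineCircU I hΛ hF Rf Z D E σ T kF hk hroom).runOn 0 ψ =
      (QFTStage.stageCircuit (qftBlock I hΛ kF hroom) hk).toMatrix 0 *ᵥ
        (stageMat hΛ hF (placeGate (subE hΛ Z) (tidyCirc (Rf.family.circ Λ.kq)).mat) *ᵥ
          ((cnotLayer σ T).toMatrix 0 *ᵥ ((GRStage.stageCircuit D E).toMatrix 0 *ᵥ ψ))) := by
  rw [QCircuit.runOn, machineCircU, QCircuit.toMatrix_append, QCircuit.toMatrix_append, QCircuit.toMatrix_append,
    toMatrix_stageCirc, Matrix.mulVec_mulVec, Matrix.mulVec_mulVec, Matrix.mulVec_mulVec, Matrix.mul_assoc, Matrix.mul_assoc]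

/-- **The data-free machine circuit agrees with `machineCirc` on every basis label whose sources carry the erase
pattern.** Let the targets `T` be distinct, no target a source, every source off the blocks, and let `Lr` be (as a
set) the targets whose source bit is set in the label `z`. Then `machineCircU … σ T` and `machineCirc … Lr` run on
`|z⟩` give the same state. [cite: Regev2009, Lemma 3.14 (proof)] [cite: NielsenChuang2010, §3.2.5, §2.1.7] -/
theorem runOn_machineCircU_eq_runOn_machineCirc (hF : Fits Λ) (Rf : UniformQCircuitFamily)
    (Z : SubZone Λ (Rf.family.ancillas Λ.kq)) {B : ℕ} {kit : GadgetKit B} {ws : Fin Λ.ℓ ↪ Fin B} {np : ℕ} {pw : Fin np ↪ Fin B}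
    {ag : Fin Λ.ℓ → (Fin Λ.ℓ → Bool) → ℝ} (D : GRBlock.Data kit ws pw ag) {E : Fin I.n → (Fin B ↪ Fin W)} (hE : BlockDisjoint E)
    (σ : Fin W → Fin W) (T : List (Fin W)) (hT : T.Nodup) (hσ : ∀ t ∈ T, σ t ∉ T) (hoff : ∀ t ∈ T, OffBlocks E (σ t))
    (Lr : List (Fin W)) (hLr : Lr.Nodup) (z : QReg W) (hmem : ∀ w, w ∈ Lr ↔ w ∈ T ∧ z (σ w) = true)
    (kF : ℕ) (hk : 1 ≤ kF) (hroom : Λ.base + I.n * QFTKit.qbsize Λ.ℓR kF ≤ W) :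
    (machineCircU I hΛ hF Rf Z D E σ T kF hk hroom).runOn 0 (basisState z) =
      (machineCirc I hΛ hF Rf Z D E Lr kF hk hroom).runOn 0 (basisState z) := by
  rw [runOn_machineCircU, runOn_machineCirc]
  congr 2
  have hψ : ∀ z', ((GRStage.stageCircuit D E).toMatrix 0 *ᵥ basisState z) z' ≠ 0 → ∀ t ∈ T, z' (σ t) = (fun t => z (σ t)) t := by
    intro z' hz' t ht
    rw [GRStage.stageCircuit_mulVec_basisState D hE z, prodState_apply] at hz'
    by_contra hne
    exact hz' (by rw [if_neg (fun hall => hne (hall (σ t) (hoff t ht))), zero_mul])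
  rw [cnotLayer_mulVec_eq_notLayer_mulVec 0 σ T hT hσ (fun t => z (σ t)) hψ]
  exact notLayer_mulVec_congr 0 (hT.filter _) hLr (fun w => by simp only [List.mem_filter, hmem w]) _

end SamplerRegs

end Regev2009

end Literature.Computability.Cryptography

end
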